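import Literature.Combinatorics.Sahi2008.Indicators
import Literature.Combinatorics.Sahi2008.Symmetry
import Literature.Combinatorics.Sahi2008.PushForward

/-!
# Strictness of Sahi's hierarchy at every order, IV: the poset `P_w = {⊥ < m_1,…,m_w < ⊤}`, its light law, its up-sets

Support file of the master-family programme (crux `NoHeavyLowerTail`, stmt-CriticalPhenomena-4575; cell `prim-masterthm`,
seat P4, unit `prim-masterthm-p4-g4`).  The carrier of the witnesses of `SahiMasterFamilyStrictHierarchy`
(generalising the six-point poset `SahiC3NotC4.P6` of the `C₃ ⇏ C₄` witness to any number `w` of middle atoms):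

* `PW w` — a bottom `bot`, `w` pairwise incomparable atoms `mid j`, a top `top`; `PartialOrder`, `Fintype` (via
  `Option (Option (Fin w))`), `PW.sum_univ`, `PW.card_univ = w + 2`, width `w` (`PW.exists_le_of_fin_succ`: among `w+1` points two
  are comparable);
* `muW w ε t` — the law `β·δ_⊥ + ε·Σ_j δ_{m_j} + t·δ_⊤` (`β = 1 − wε − t`): total mass one, nonnegative, and LIGHT off `⊥`:
  an up-set other than `univ` avoids `⊥`, so all its atoms have mass `≤ max ε t` (`muW_light`);
* up-sets: a nonempty up-set contains `top`; an up-set containing `bot` is everything (`eq_univ_of_bot_mem`);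
* branching at a trivial member (any finite type): if `U_i = univ` then `E_{n+2}(1_U) = n·E_{n+1}` of the other members
  (`sahiE_setInd_of_mem_univ`, from the tree's `sahiE_succ_succ_of_head_eq_one` and symmetry `sahiE_comp_perm`);
* the monotone map `toCube : PW w → Finset (Fin w)` (`⊥ ↦ ∅`, `m_j ↦ {j}`, `⊤ ↦ univ`) and the events `bad i = {⊤} ∪ {m_j : j ≠ i}`,
  `orSet i = {S : ¬ S ⊆ {i}}` with `1_{orSet i} ∘ toCube = 1_{bad i}` (for the cube form of the theorem).
HONEST FRAMING: bookkeeping; [this work].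
-/

namespace Summit.CriticalPhenomena.PercolationContinuityZ3.Theorems

open Finset Function
open Literature.Combinatorics.Sahi2008

namespace SahiStrictHierarchy

/-! ### Branching at a member equal to `univ` (any finite type) -/

section Branching

variable {α : Type*} [Fintype α] [DecidableEq α]

/-- The indicator of `univ` is the constant `1`. [folklore] -/
theorem setInd_univ : setInd (univ : Finset α) = 1 := by
  funext x
  simp [setInd]

/-- **Branching at a trivial member**: if `U_i = univ` then `E_{n+2}(1_{U_0},…,1_{U_{n+1}}) = n · E_{n+1}` of the family with
slot `i` moved to the front and dropped. [this work] -/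
theorem sahiE_setInd_of_mem_univ {μ : α → ℝ} (hμ : ∑ x, μ x = 1) {n : ℕ} (U : Fin (n + 2) → Finset α)
    {i : Fin (n + 2)} (hi : U i = univ) :
    sahiE μ (n + 2) (fun j => setInd (U j)) =
      n * sahiE μ (n + 1) (fun j => setInd (U (Equiv.swap 0 i j.succ))) := by
  rw [← sahiE_comp_perm μ (n + 2) (Equiv.swap 0 i) (fun j => setInd (U j))]
  rw [sahiE_succ_succ_of_head_eq_one hμ _ (by
    show setInd (U (Equiv.swap 0 i 0)) = 1
    rw [Equiv.swap_apply_left, hi, setInd_univ])]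
  rfl

end Branching

/-! ### The poset `P_w` -/

/-- The poset `P_w`: a bottom, `w` pairwise incomparable middle atoms, a top. [this work] -/
inductive PW (w : ℕ) : Type
  | bot : PW w
  | mid : Fin w → PW w
  | top : PW w
  deriving DecidableEq

namespace PW

variable {w : ℕ}

/-- `P_w` coded in `Option (Option (Fin w))`. [this work] -/
def toOpt : PW w → Option (Option (Fin w))
  | bot => none
  | top => some none
  | mid j => some (some j)

/-- Decoding. [this work] -/
def ofOpt : Option (Option (Fin w)) → PW w
  | none => bot
  | some none => top
  | some (some j) => mid j

/-- `P_w ≃ Option (Option (Fin w))`. [this work] -/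
def equivOption : PW w ≃ Option (Option (Fin w)) where
  toFun := toOpt
  invFun := ofOpt
  left_inv x := by cases x <;> rfl
  right_inv x := by rcases x with _ | _ | j <;> rfl

/-- `P_w` is finite. [this work] -/
instance : Fintype (PW w) := Fintype.ofEquiv _ equivOption.symm

/-- `|P_w| = w + 2`. [this work] -/
theorem card_univ : Fintype.card (PW w) = w + 2 := by
  rw [Fintype.ofEquiv_card]
  simp [Fintype.card_option]

/-- Sums over `P_w`, term by term. [this work] -/
theorem sum_univ {M : Type*} [AddCommMonoid M] (f : PW w → M) : ∑ x, f x = f bot + f top + ∑ j, f (mid j) := by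
  rw [Fintype.sum_equiv equivOption f (f ∘ ofOpt) fun x => by cases x <;> rfl]
  rw [Fintype.sum_option, Fintype.sum_option]
  simp only [comp_apply, ofOpt, add_assoc]

/-- The order: `⊥` below everything, `⊤` above everything, the atoms pairwise incomparable. [this work] -/
instance : LE (PW w) := ⟨fun a b => a = bot ∨ b = top ∨ a = b⟩

/-- `≤` on `P_w` is decidable. [this work] -/
instance decLE : DecidableRel (α := PW w) (· ≤ ·) :=
  fun a b => inferInstanceAs (Decidable (a = bot ∨ b = top ∨ a = b))

/-- Unfolding `≤`. [this work] -/
theorem le_def (a b : PW w) : a ≤ b ↔ a = bot ∨ b = top ∨ a = b := Iff.rfl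

/-- `P_w` is a partial order. [this work] -/
instance : PartialOrder (PW w) where
  le := (· ≤ ·)
  le_refl a := Or.inr (Or.inr rfl)
  le_trans a b c hab hbc := by
    rw [le_def] at hab hbc ⊢
    rcases hab with rfl | rfl | rfl
    · exact Or.inl rfl
    · rcases hbc with h | rfl | rfl
      · exact absurd h (by simp)
      · exact Or.inr (Or.inl rfl)
      · exact Or.inr (Or.inl rfl)
    · exact hbc
  le_antisymm a b hab hba := by
    rw [le_def] at hab hba
    rcases hab with rfl | rfl | rfl
    · rcases hba with h | h | h
      · exact h.symm
      · exact absurd h (by simp)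
      · exact h.symm
    · rcases hba with h | h | h
      · exact absurd h (by simp)
      · exact h
      · exact h.symm
    · rfl

/-- `⊥ ≤ a`. [this work] -/
theorem bot_le (a : PW w) : bot ≤ a := Or.inl rfl

/-- `a ≤ ⊤`. [this work] -/
theorem le_top (a : PW w) : a ≤ top := Or.inr (Or.inl rfl)

/-- Atoms are comparable only when equal. [this work] -/
theorem mid_le_mid_iff {i j : Fin w} : mid i ≤ mid j ↔ i = j := by
  rw [le_def]
  simp

/-- **`P_w` has width `w`**: among any `w + 1` points two (with distinct indices) are comparable. [this work] -/
theorem exists_le_of_fin_succ (hw : 1 ≤ w) (y : Fin (w + 1) → PW w) : ∃ i j, i ≠ j ∧ y i ≤ y j := by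
  have h01 : (0 : Fin (w + 1)) ≠ ⟨1, by omega⟩ := by
    intro h; exact absurd (congrArg Fin.val h) (by simp)
  by_cases hb : ∃ i, y i = bot
  · obtain ⟨i, hi⟩ := hb
    obtain ⟨j, hj⟩ : ∃ j : Fin (w + 1), j ≠ i := by
      by_cases h : i = 0
      · exact ⟨⟨1, by omega⟩, fun e => h01 (h ▸ e).symm⟩
      · exact ⟨0, fun e => h e.symm⟩
    exact ⟨i, j, hj.symm, hi ▸ bot_le _⟩
  by_cases ht : ∃ i, y i = top
  · obtain ⟨i, hi⟩ := ht
    obtain ⟨j, hj⟩ : ∃ j : Fin (w + 1), j ≠ i := by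
      by_cases h : i = 0
      · exact ⟨⟨1, by omega⟩, fun e => h01 (h ▸ e).symm⟩
      · exact ⟨0, fun e => h e.symm⟩
    exact ⟨j, i, hj, hi ▸ le_top _⟩
  push Not at hb ht
  have hmid : ∀ i, ∃ j, y i = mid j := fun i => by
    cases h : y i with
    | bot => exact absurd h (hb i)
    | mid j => exact ⟨j, rfl⟩
    | top => exact absurd h (ht i)
  choose f hf using hmid
  obtain ⟨i, j, hij, hfij⟩ := Fintype.exists_ne_map_eq_of_card_lt f (by simp)
  exact ⟨i, j, hij, by rw [hf i, hf j, hfij]⟩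

/-! ### Up-sets of `P_w` -/

/-- A nonempty up-set contains `⊤`. [this work] -/
theorem top_mem_of_isUpperSet {U : Finset (PW w)} (hU : IsUpperSet (U : Set (PW w))) (hne : U.Nonempty) : top ∈ U := by
  obtain ⟨x, hx⟩ := hne
  exact hU (le_top x) hx

/-- An up-set containing `⊥` is everything. [this work] -/
theorem eq_univ_of_bot_mem {U : Finset (PW w)} (hU : IsUpperSet (U : Set (PW w))) (hb : bot ∈ U) : U = univ :=
  eq_univ_of_forall fun x => hU (bot_le x) hb

/-- A proper up-set avoids `⊥`. [this work] -/
theorem bot_not_mem {U : Finset (PW w)} (hU : IsUpperSet (U : Set (PW w))) (hne : U ≠ univ) : bot ∉ U :=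
  fun hb => hne (eq_univ_of_bot_mem hU hb)

/-! ### The light law `μ = β·δ_⊥ + ε·Σ δ_{m_j} + t·δ_⊤` -/

/-- The law with mass `ε` on each atom, `t` on `⊤`, the rest on `⊥`. [this work] -/
noncomputable def muW (w : ℕ) (ε t : ℝ) : PW w → ℝ
  | bot => 1 - w * ε - t
  | mid _ => ε
  | top => t

/-- Total mass one. [this work] -/
theorem sum_muW (ε t : ℝ) : ∑ x, muW w ε t x = 1 := by
  rw [sum_univ]
  simp only [muW, sum_const, Finset.card_univ, Fintype.card_fin, nsmul_eq_mul]
  ring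

/-- Nonnegative when `wε + t ≤ 1`. [this work] -/
theorem muW_nonneg {ε t : ℝ} (hε : 0 ≤ ε) (ht : 0 ≤ t) (h : w * ε + t ≤ 1) (x : PW w) : 0 ≤ muW w ε t x := by
  cases x with
  | bot => simp only [muW]; linarith
  | mid j => exact hε
  | top => exact ht

/-- **Lightness**: every atom of a proper up-set has mass in `[0, ε]` (when `0 ≤ t ≤ ε`). [this work] -/
theorem muW_light {ε t : ℝ} (ht0 : 0 ≤ t) (htε : t ≤ ε) {U : Finset (PW w)} (hU : IsUpperSet (U : Set (PW w)))
    (hne : U ≠ univ) : ∀ a ∈ U, 0 ≤ muW w ε t a ∧ muW w ε t a ≤ ε := by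
  intro a ha
  cases a with
  | bot => exact absurd ha (bot_not_mem hU hne)
  | mid j => exact ⟨ht0.trans htε, le_rfl⟩
  | top => exact ⟨ht0, htε⟩

/-! ### The violating family and the cube -/

/-- `U_i = {⊤} ∪ {m_j : j ≠ i}`. [this work] -/
def bad (i : Fin w) : Finset (PW w) := univ.filter fun x => x ≠ bot ∧ x ≠ mid i

/-- Membership in `bad i`. [this work] -/
theorem mem_bad {i : Fin w} {x : PW w} : x ∈ bad i ↔ x ≠ bot ∧ x ≠ mid i := by
  simp [bad]

/-- `bad i` is an up-set. [this work] -/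
theorem isUpperSet_bad (i : Fin w) : IsUpperSet (bad i : Set (PW w)) := by
  intro a b hab ha
  rw [mem_coe, mem_bad] at ha ⊢
  rcases (le_def a b).1 hab with rfl | rfl | rfl
  · exact absurd rfl ha.1
  · exact ⟨by simp, by simp⟩
  · exact ha

/-- `bad i ≠ univ`. [this work] -/
theorem bad_ne_univ (i : Fin w) : bad i ≠ (univ : Finset (PW w)) := by
  intro h
  have : (bot : PW w) ∈ bad i := h ▸ mem_univ _
  exact (mem_bad.1 this).1 rfl

/-- `⊤ ∈ bad i`, `m_i ∉ bad i`, `m_j ∈ bad i` for `j ≠ i`. [this work] -/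
theorem mem_bad_iff_of_mid {i j : Fin w} : mid j ∈ bad i ↔ j ≠ i := by
  rw [mem_bad]
  simp

/-- `⊤ ∈ bad i`. [this work] -/
theorem top_mem_bad (i : Fin w) : top ∈ bad i := by
  rw [mem_bad]; exact ⟨by simp, by simp⟩

/-- The monotone coding of `P_w` in the cube `2^{[w]}`: `⊥ ↦ ∅`, `m_j ↦ {j}`, `⊤ ↦ [w]`. [this work] -/
def toCube : PW w → Finset (Fin w)
  | bot => ∅
  | mid j => {j}
  | top => univ

/-- `toCube` is monotone. [this work] -/
theorem toCube_monotone : Monotone (toCube : PW w → Finset (Fin w)) := by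
  intro a b hab
  rcases (le_def a b).1 hab with rfl | rfl | rfl
  · exact Finset.empty_subset _
  · exact Finset.subset_univ _
  · exact le_rfl

/-- The cube event "some coordinate other than `i` is on": `{S : ¬ S ⊆ {i}}` (an up-set of `2^{[w]}`). [this work] -/
def orSet (i : Fin w) : Finset (Finset (Fin w)) := univ.filter fun S => ¬ S ⊆ {i}

/-- `orSet i` is an up-set of the cube. [this work] -/
theorem isUpperSet_orSet (i : Fin w) : IsUpperSet (orSet i : Set (Finset (Fin w))) := by
  intro S T hST hS
  simp only [orSet, coe_filter, mem_univ, true_and, Set.mem_setOf_eq] at hS ⊢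
  exact fun h => hS (hST.trans h)

/-- `toCube x ∈ orSet i ↔ x ∈ bad i` (needs `w ≥ 2` for `⊤`). [this work] -/
theorem toCube_mem_orSet_iff (hw : 2 ≤ w) (i : Fin w) (x : PW w) : toCube x ∈ orSet i ↔ x ∈ bad i := by
  rw [mem_bad]
  simp only [orSet, mem_filter, mem_univ, true_and]
  cases x with
  | bot => simp [toCube]
  | mid j => simp [toCube]
  | top =>
    simp only [toCube, ne_eq, reduceCtorEq, not_false_eq_true, and_self, iff_true]
    intro h
    obtain ⟨j, hj⟩ : ∃ j : Fin w, j ≠ i := by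
      by_cases hi : i = ⟨0, by omega⟩
      · exact ⟨⟨1, by omega⟩, fun e => by rw [hi] at e; exact absurd (congrArg Fin.val e) (by simp)⟩
      · exact ⟨⟨0, by omega⟩, fun e => hi e.symm⟩
    exact hj (mem_singleton.1 (h (mem_univ j)))

/-- `1_{orSet i} ∘ toCube = 1_{bad i}`. [this work] -/
theorem setInd_orSet_comp_toCube (hw : 2 ≤ w) (i : Fin w) : setInd (orSet i) ∘ toCube = setInd (bad i : Finset (PW w)) := by
  funext x
  simp only [comp_apply, setInd, toCube_mem_orSet_iff hw]

end PW

end SahiStrictHierarchy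

end Summit.CriticalPhenomena.PercolationContinuityZ3.Theorems
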